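import Summits.NavierStokesRegularity.NavierStokesRegularity.Theorems.ExtremiserTransienceNearExtremalTransienceExtremiserLiouvilleConstantSpeedSlidePalinstrophyRemainder
import Summits.NavierStokesRegularity.NavierStokesRegularity.Theorems.ExtremiserTransienceNearExtremalTransienceExtremiserLiouvilleConstantSpeedSlidePalinstrophyLimit
import Summits.NavierStokesRegularity.NavierStokesRegularity.Theorems.ExtremiserTransienceNearExtremalTransienceExtremiserLiouvilleConstantSpeedSlideKinematics
import Summits.NavierStokesRegularity.NavierStokesRegularity.Theorems.ExtremiserTransienceNearExtremalTransienceExtremiserLiouvilleConstantSpeedSlideEnstrophyLawJet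
import HarnessLib

/-!
# Crux `ExtremiserTransience.NearExtremalTransience` (stmt-NavierStokesRegularity-21883), line `extremiser_liouville`,
# stub K1b — THE CROSS TERM `g‴⟪∂₂ω, B⟫` OF `ĉ₁` IS A `V₂`-TERM FOR THE JET (record §15, the (KIN) step of R6a-int for the bare term)

`--supports stmt-NavierStokesRegularity-21883` (helper).  Author: prover seat `ns-el-k1b` (g9).

In the explicit palinstrophy variation `ĉ₁` of `slideInequality_layer` the only density that is LINEAR (not quadratic) in the
derivatives is `g‴(x₂)⟪∂₂ω, B⟫`, `B = (−V₁, V₀, 0) = e₂ × V` — the Lean avatar of the bare term `½∫γ⁗‖V_h‖²` of record §2 (T2).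
Here it is converted, exactly as the record's (KIN) prescribes:
* `inner_curl_crossField` : `⟪ω, B⟫ = ⟪V_h, ∂₂V_h⟫ − ⟪V_h, ∇_hV₂⟫` (the integrand of `integral_slideTail_eq`, p719161);
* `fderiv_inner_curl_crossField_axis` : `∂₂⟪ω, B⟫ = ⟪∂₂ω, B⟫ + ⟪ω, ∂₂B⟫`;
* `integral_axialWeight_inner_fderiv_curl_crossField` : **`∫w(x₂)⟪∂₂ω,B⟫ = ½∫w″(x₂)(‖V‖² − 2V₂²) − ∫w(x₂)⟪ω,∂₂B⟫`** for
  div-free `V` (`D¹V, D²V ∈ L²`, slab square integrable; `w ∈ C²`, `w, w′, w″` bounded and `= 0` on `{T ≤ |s|}`) — axial rule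
  (p720690) + slide tail (p719161);
* `integral_axialWeight_inner_fderiv_curl_crossField_jet` : for the residue JET (`⟪V,c⟫ = −‖V‖²/2`, `c = (0,0,c₂)`, flux
  invariance p670434: `∫w″‖V‖² = 0`) **`∫w⟪∂₂ω,B⟫ = −∫w″V₂² − ∫w⟪ω,∂₂B⟫`** — quadratic in `DV` plus a `V₂`-term
  (`V₂ = −‖V‖²/2M` is small in the far field), i.e. absorbable in R6b.

WHAT THIS IS NOT: K1b is NOT proved; nothing here proves NS regularity. [folklore]
-/

noncomputable section

open Set Filter Topology MeasureTheory Metric Function InnerProductSpace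
open scoped ENNReal NNReal Topology InnerProductSpace RealInnerProductSpace ContDiff
open Literature.Analysis.FluidPDE Literature.Analysis

namespace Summit.NavierStokesRegularity.NavierStokesRegularity.Theorems

-- the problem directory repeats the summit name (`NavierStokesRegularity/NavierStokesRegularity`)
set_option linter.dupNamespace false

namespace ExtremiserLiouville

open DepletionLadder.KStar

variable {V : EuclideanSpace ℝ (Fin 3) → EuclideanSpace ℝ (Fin 3)} {w : ℝ → ℝ} {c : EuclideanSpace ℝ (Fin 3)}

/-! ## 1. Pointwise -/

/-- `⟪ω, B⟫ = ⟪V_h, ∂₂V_h⟫ − ⟪V_h, ∇_hV₂⟫` for `B = (−V₁, V₀, 0)`. [folklore] -/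
theorem inner_curl_crossField (x : EuclideanSpace ℝ (Fin 3)) :
    ⟪curl V x, ((-V x 1) • EuclideanSpace.single (0 : Fin 3) (1 : ℝ) + (V x 0) • EuclideanSpace.single (1 : Fin 3) (1 : ℝ))⟫ =
      ((V x 0 * fderiv ℝ V x (EuclideanSpace.single 2 1) 0 + V x 1 * fderiv ℝ V x (EuclideanSpace.single 2 1) 1) -
          (V x 0 * fderiv ℝ V x (EuclideanSpace.single 0 1) 2 + V x 1 * fderiv ℝ V x (EuclideanSpace.single 1 1) 2)) := by
  have h0 : curl V x 0 = fderiv ℝ V x (EuclideanSpace.single 1 1) 2 - fderiv ℝ V x (EuclideanSpace.single 2 1) 1 := by simp [curl]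
  have h1 : curl V x 1 = fderiv ℝ V x (EuclideanSpace.single 2 1) 0 - fderiv ℝ V x (EuclideanSpace.single 0 1) 2 := by simp [curl]
  rw [inner_add_right, inner_smul_right, inner_smul_right, EuclideanSpace.inner_single_right, EuclideanSpace.inner_single_right]
  simp only [conj_trivial, h0, h1]
  ring

/-- `∂₂⟪ω, B⟫ = ⟪∂₂ω, B⟫ + ⟪ω, ∂₂B⟫`. [folklore] -/
theorem fderiv_inner_curl_crossField_axis (hV : ContDiff ℝ ∞ V) (x : EuclideanSpace ℝ (Fin 3)) :
    fderiv ℝ (fun y : EuclideanSpace ℝ (Fin 3) => ⟪curl V y, (-V y 1) • EuclideanSpace.single (0 : Fin 3) (1 : ℝ) + (V y 0) • EuclideanSpace.single (1 : Fin 3) (1 : ℝ)⟫) x (EuclideanSpace.single (2 : Fin 3) (1 : ℝ)) =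
      ⟪fderiv ℝ (curl V) x (EuclideanSpace.single (2 : Fin 3) (1 : ℝ)), ((-V x 1) • EuclideanSpace.single (0 : Fin 3) (1 : ℝ) + (V x 0) • EuclideanSpace.single (1 : Fin 3) (1 : ℝ))⟫ +
        ⟪curl V x, fderiv ℝ (fun z : EuclideanSpace ℝ (Fin 3) => (-V z 1) • EuclideanSpace.single (0 : Fin 3) (1 : ℝ) + (V z 0) • EuclideanSpace.single (1 : Fin 3) (1 : ℝ)) x (EuclideanSpace.single (2 : Fin 3) (1 : ℝ))⟫ := by
  have hω : ContDiff ℝ ∞ (curl V) := contDiff_curl (n := ⊤) (hV.of_le (by exact_mod_cast le_top))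
  have hωd : Differentiable ℝ (curl V) := hω.differentiable (by simp)
  have hBd : Differentiable ℝ (fun z : EuclideanSpace ℝ (Fin 3) => (-V z 1) • EuclideanSpace.single (0 : Fin 3) (1 : ℝ) + (V z 0) • EuclideanSpace.single (1 : Fin 3) (1 : ℝ)) := (contDiff_crossField hV).differentiable (by simp)
  rw [((hωd x).hasFDerivAt.inner ℝ (hBd x).hasFDerivAt).fderiv]
  simp only [fderivInnerCLM_apply, ContinuousLinearMap.prod_apply, ContinuousLinearMap.coe_comp, Function.comp_apply]
  rw [add_comm]

/-! ## 2. The integrated identity -/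

/-- **`∫w(x₂)⟪∂₂ω, B⟫ = ½∫w″(x₂)(‖V‖² − 2V₂²) − ∫w(x₂)⟪ω, ∂₂B⟫`** for a divergence-free `V` with `D¹V, D²V ∈ L²`
on a square-integrable layer (`w ∈ C²`; `w, w′` bounded by `K` and `= 0` on `{T ≤ |s|}`). [folklore] -/
theorem integral_axialWeight_inner_fderiv_curl_crossField (hV : ContDiff ℝ ∞ V) (hdiv : VectorCalculus.IsDivFree V)
    (hw : ContDiff ℝ 2 w) {K T : ℝ} (hwK : ∀ s, |w s| ≤ K) (hw1K : ∀ s, |deriv w s| ≤ K) (hw2K : ∀ s, |deriv (deriv w) s| ≤ K)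
    (hwT : ∀ s, T ≤ |s| → w s = 0) (hw1T : ∀ s, T ≤ |s| → deriv w s = 0) (hw2T : ∀ s, T ≤ |s| → deriv (deriv w) s = 0)
    (h1 : ∫⁻ x, ‖iteratedFDeriv ℝ 1 V x‖ₑ ^ 2 < ⊤) (h2 : ∫⁻ x, ‖iteratedFDeriv ℝ 2 V x‖ₑ ^ 2 < ⊤)
    (hslab : Integrable (fun x => {x : EuclideanSpace ℝ (Fin 3) | |x 2| ≤ T}.indicator (fun x => ‖V x‖ ^ 2) x) volume) :
    (∫ x, w (x 2) * ⟪fderiv ℝ (curl V) x (EuclideanSpace.single (2 : Fin 3) (1 : ℝ)), ((-V x 1) • EuclideanSpace.single (0 : Fin 3) (1 : ℝ) + (V x 0) • EuclideanSpace.single (1 : Fin 3) (1 : ℝ))⟫) =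
      (1 / 2) * (∫ x, deriv (deriv w) (x 2) * (‖V x‖ ^ 2 - 2 * (V x 2) ^ 2)) -
        ∫ x, w (x 2) * ⟪curl V x, fderiv ℝ (fun z : EuclideanSpace ℝ (Fin 3) => (-V z 1) • EuclideanSpace.single (0 : Fin 3) (1 : ℝ) + (V z 0) • EuclideanSpace.single (1 : Fin 3) (1 : ℝ)) x (EuclideanSpace.single (2 : Fin 3) (1 : ℝ))⟫ := by
  set SL : Set (EuclideanSpace ℝ (Fin 3)) := {x | |x 2| ≤ T} with hSL
  have hK0 : 0 ≤ K := (abs_nonneg _).trans (hwK 0)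
  have hv1 : ContDiff ℝ 1 V := hV.of_le (WithTop.coe_le_coe.mpr le_top)
  have hw1 : ContDiff ℝ 1 w := hw.of_le (by norm_num)
  have hw' : ContDiff ℝ 1 (deriv w) := by
    have h2' : ContDiff ℝ (1 + 1) w := by rw [show ((1 : WithTop ℕ∞) + 1) = 2 by norm_num]; exact hw
    exact h2'.deriv'
  have hω : ContDiff ℝ ∞ (curl V) := contDiff_curl (n := ⊤) (hV.of_le (by exact_mod_cast le_top))
  have hB : ContDiff ℝ ∞ (fun z : EuclideanSpace ℝ (Fin 3) => (-V z 1) • EuclideanSpace.single (0 : Fin 3) (1 : ℝ) + (V z 0) • EuclideanSpace.single (1 : Fin 3) (1 : ℝ)) := contDiff_crossField hV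
  have cV : Continuous V := hV.continuous
  have cω : Continuous (curl V) := hω.continuous
  have cDV : Continuous (fderiv ℝ V) := hV.continuous_fderiv (by simp)
  have cB : Continuous (fun z : EuclideanSpace ℝ (Fin 3) => (-V z 1) • EuclideanSpace.single (0 : Fin 3) (1 : ℝ) + (V z 0) • EuclideanSpace.single (1 : Fin 3) (1 : ℝ)) := hB.continuous
  have cDB : Continuous (fderiv ℝ (fun z : EuclideanSpace ℝ (Fin 3) => (-V z 1) • EuclideanSpace.single (0 : Fin 3) (1 : ℝ) + (V z 0) • EuclideanSpace.single (1 : Fin 3) (1 : ℝ))) := hB.continuous_fderiv (by simp)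
  obtain ⟨cDω, mDω⟩ := memLp_fderiv_curl hV h2
  have iDω := integrable_sq_of_memLp_two mDω
  have cw : Continuous fun x : EuclideanSpace ℝ (Fin 3) => w (x 2) := hw.continuous.comp (PiLp.continuous_apply 2 _ (2 : Fin 3))
  have cw' : Continuous fun x : EuclideanSpace ℝ (Fin 3) => deriv w (x 2) := hw'.continuous.comp (PiLp.continuous_apply 2 _ (2 : Fin 3))
  -- `ω ∈ L²`, `DV ∈ L²`
  have hD1 : Integrable (fun x => ‖iteratedFDeriv ℝ 1 V x‖ ^ 2) (volume : Measure (EuclideanSpace ℝ (Fin 3))) :=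
    integrable_sq_norm_of_lintegral (hV.continuous_iteratedFDeriv (WithTop.coe_le_coe.mpr le_top)) h1
  have iD : Integrable (fun x => ‖fderiv ℝ V x‖ ^ 2) (volume : Measure (EuclideanSpace ℝ (Fin 3))) := by
    refine hD1.congr (Eventually.of_forall fun x => ?_); dsimp only; rw [← norm_iteratedFDeriv_fderiv, norm_iteratedFDeriv_zero]
  have iZ : Integrable (fun x => ‖curl V x‖ ^ 2) (volume : Measure (EuclideanSpace ℝ (Fin 3))) := by
    refine (hD1.const_mul (4 ^ 2)).mono' (cω.norm.pow 2).aestronglyMeasurable (Eventually.of_forall fun x => ?_)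
    rw [Real.norm_eq_abs, abs_of_nonneg (sq_nonneg _), ← mul_pow]
    have := norm_iteratedFDeriv_curl_le_four hV 0 x
    rw [norm_iteratedFDeriv_zero] at this
    exact pow_le_pow_left₀ (norm_nonneg _) this 2
  have nB : ∀ x, ‖(-V x 1) • EuclideanSpace.single (0 : Fin 3) (1 : ℝ) + (V x 0) • EuclideanSpace.single (1 : Fin 3) (1 : ℝ)‖ ≤ ‖V x‖ := fun x => norm_cross_le (V x)
  have nDB : ∀ x, ‖fderiv ℝ (fun z : EuclideanSpace ℝ (Fin 3) => (-V z 1) • EuclideanSpace.single (0 : Fin 3) (1 : ℝ) + (V z 0) • EuclideanSpace.single (1 : Fin 3) (1 : ℝ)) x (EuclideanSpace.single (2 : Fin 3) (1 : ℝ))‖ ≤ ‖fderiv ℝ V x‖ := by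
    intro x
    have e1 : ‖iteratedFDeriv ℝ 0 (fderiv ℝ (fun z : EuclideanSpace ℝ (Fin 3) => (-V z 1) • EuclideanSpace.single (0 : Fin 3) (1 : ℝ) + (V z 0) • EuclideanSpace.single (1 : Fin 3) (1 : ℝ))) x‖ = ‖iteratedFDeriv ℝ 1 (fun z : EuclideanSpace ℝ (Fin 3) => (-V z 1) • EuclideanSpace.single (0 : Fin 3) (1 : ℝ) + (V z 0) • EuclideanSpace.single (1 : Fin 3) (1 : ℝ)) x‖ := norm_iteratedFDeriv_fderiv
    rw [norm_iteratedFDeriv_zero] at e1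
    have h := norm_iteratedFDeriv_crossField_le hV 1 x
    rw [← e1, ← norm_iteratedFDeriv_fderiv, norm_iteratedFDeriv_zero] at h
    refine ((fderiv ℝ (fun z : EuclideanSpace ℝ (Fin 3) => (-V z 1) • EuclideanSpace.single (0 : Fin 3) (1 : ℝ) + (V z 0) • EuclideanSpace.single (1 : Fin 3) (1 : ℝ)) x).le_opNorm _).trans ?_
    rw [PiLp.norm_single, norm_one, mul_one]; exact h
  -- slab bounds for slab-supported weights
  have slabpt : ∀ (u : ℝ → ℝ), (∀ s, |u s| ≤ K) → (∀ s, T ≤ |s| → u s = 0) → ∀ x, |u (x 2)| * ‖V x‖ ^ 2 ≤ K * SL.indicator (fun x => ‖V x‖ ^ 2) x := by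
    intro u huK huT x
    by_cases hx : x ∈ SL
    · rw [Set.indicator_of_mem hx]; exact mul_le_mul_of_nonneg_right (huK _) (sq_nonneg _)
    · rw [huT _ (not_le.1 hx).le, abs_zero, zero_mul, Set.indicator_of_notMem hx, mul_zero]
  -- the scalar `p = ⟪ω, B⟫` and the axial rule
  have hp : ContDiff ℝ 1 fun y : EuclideanSpace ℝ (Fin 3) => ⟪curl V y, (-V y 1) • EuclideanSpace.single (0 : Fin 3) (1 : ℝ) + (V y 0) • EuclideanSpace.single (1 : Fin 3) (1 : ℝ)⟫ :=
    (hω.inner ℝ hB).of_le (WithTop.coe_le_coe.mpr le_top)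
  have ip : ∀ (u : ℝ → ℝ), Continuous u → (∀ s, |u s| ≤ K) → (∀ s, T ≤ |s| → u s = 0) →
      Integrable (fun x => u (x 2) * ⟪curl V x, (-V x 1) • EuclideanSpace.single (0 : Fin 3) (1 : ℝ) + (V x 0) • EuclideanSpace.single (1 : Fin 3) (1 : ℝ)⟫) volume := by
    intro u huc huK huT
    refine (((iZ.const_mul K).add (hslab.const_mul K)).const_mul (1 / 2)).mono'
      (((huc.comp (PiLp.continuous_apply 2 _ (2 : Fin 3))).mul (cω.inner cB)).aestronglyMeasurable) (Eventually.of_forall fun x => ?_)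
    rw [Real.norm_eq_abs, abs_mul]
    simp only [Pi.add_apply]
    have h1' : |⟪curl V x, (-V x 1) • EuclideanSpace.single (0 : Fin 3) (1 : ℝ) + (V x 0) • EuclideanSpace.single (1 : Fin 3) (1 : ℝ)⟫| ≤ ‖curl V x‖ * ‖V x‖ :=
      (abs_real_inner_le_norm _ _).trans (mul_le_mul_of_nonneg_left (nB x) (norm_nonneg _))
    have hsl := slabpt u huK huT x
    have hu := huK (x 2)
    calc |u (x 2)| * |⟪curl V x, (-V x 1) • EuclideanSpace.single (0 : Fin 3) (1 : ℝ) + (V x 0) • EuclideanSpace.single (1 : Fin 3) (1 : ℝ)⟫| ≤ |u (x 2)| * (‖curl V x‖ * ‖V x‖) :=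
          mul_le_mul_of_nonneg_left h1' (abs_nonneg _)
      _ ≤ |u (x 2)| * ((‖curl V x‖ ^ 2 + ‖V x‖ ^ 2) / 2) := by
          refine mul_le_mul_of_nonneg_left ?_ (abs_nonneg _); nlinarith [sq_nonneg (‖curl V x‖ - ‖V x‖)]
      _ = 1 / 2 * (|u (x 2)| * ‖curl V x‖ ^ 2 + |u (x 2)| * ‖V x‖ ^ 2) := by ring
      _ ≤ 1 / 2 * (K * ‖curl V x‖ ^ 2 + K * SL.indicator (fun x => ‖V x‖ ^ 2) x) := by
          refine mul_le_mul_of_nonneg_left (add_le_add (mul_le_mul_of_nonneg_right hu (sq_nonneg _)) hsl) (by norm_num)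
  have i0 := ip w hw.continuous hwK hwT
  have i1 := ip (deriv w) hw'.continuous hw1K hw1T
  have hpt : ∀ x, w (x 2) * fderiv ℝ (fun y : EuclideanSpace ℝ (Fin 3) => ⟪curl V y, (-V y 1) • EuclideanSpace.single (0 : Fin 3) (1 : ℝ) + (V y 0) • EuclideanSpace.single (1 : Fin 3) (1 : ℝ)⟫) x (EuclideanSpace.single (2 : Fin 3) (1 : ℝ)) =
      w (x 2) * ⟪fderiv ℝ (curl V) x (EuclideanSpace.single (2 : Fin 3) (1 : ℝ)), ((-V x 1) • EuclideanSpace.single (0 : Fin 3) (1 : ℝ) + (V x 0) • EuclideanSpace.single (1 : Fin 3) (1 : ℝ))⟫ +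
        w (x 2) * ⟪curl V x, fderiv ℝ (fun z : EuclideanSpace ℝ (Fin 3) => (-V z 1) • EuclideanSpace.single (0 : Fin 3) (1 : ℝ) + (V z 0) • EuclideanSpace.single (1 : Fin 3) (1 : ℝ)) x (EuclideanSpace.single (2 : Fin 3) (1 : ℝ))⟫ := fun x => by
    rw [fderiv_inner_curl_crossField_axis hV x]; ring
  have iA : Integrable (fun x => w (x 2) * ⟪fderiv ℝ (curl V) x (EuclideanSpace.single (2 : Fin 3) (1 : ℝ)), ((-V x 1) • EuclideanSpace.single (0 : Fin 3) (1 : ℝ) + (V x 0) • EuclideanSpace.single (1 : Fin 3) (1 : ℝ))⟫) volume := by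
    refine (((iDω.const_mul K).add (hslab.const_mul K)).const_mul (1 / 2)).mono'
      ((cw.mul ((cDω.clm_apply continuous_const).inner cB)).aestronglyMeasurable) (Eventually.of_forall fun x => ?_)
    rw [Real.norm_eq_abs, abs_mul]
    simp only [Pi.add_apply]
    have hP : ‖fderiv ℝ (curl V) x (EuclideanSpace.single (2 : Fin 3) (1 : ℝ))‖ ≤ ‖fderiv ℝ (curl V) x‖ := by
      have := (fderiv ℝ (curl V) x).le_opNorm (EuclideanSpace.single (2 : Fin 3) (1 : ℝ)); rwa [PiLp.norm_single, norm_one, mul_one] at this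
    have h1' : |⟪fderiv ℝ (curl V) x (EuclideanSpace.single (2 : Fin 3) (1 : ℝ)), ((-V x 1) • EuclideanSpace.single (0 : Fin 3) (1 : ℝ) + (V x 0) • EuclideanSpace.single (1 : Fin 3) (1 : ℝ))⟫| ≤ ‖fderiv ℝ (curl V) x‖ * ‖V x‖ :=
      (abs_real_inner_le_norm _ _).trans (mul_le_mul hP (nB x) (norm_nonneg _) (norm_nonneg _))
    have hsl := slabpt w hwK hwT x
    have hu := hwK (x 2)
    calc |w (x 2)| * |⟪fderiv ℝ (curl V) x (EuclideanSpace.single (2 : Fin 3) (1 : ℝ)), ((-V x 1) • EuclideanSpace.single (0 : Fin 3) (1 : ℝ) + (V x 0) • EuclideanSpace.single (1 : Fin 3) (1 : ℝ))⟫| ≤ |w (x 2)| * (‖fderiv ℝ (curl V) x‖ * ‖V x‖) :=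
          mul_le_mul_of_nonneg_left h1' (abs_nonneg _)
      _ ≤ |w (x 2)| * ((‖fderiv ℝ (curl V) x‖ ^ 2 + ‖V x‖ ^ 2) / 2) := by
          refine mul_le_mul_of_nonneg_left ?_ (abs_nonneg _); nlinarith [sq_nonneg (‖fderiv ℝ (curl V) x‖ - ‖V x‖)]
      _ = 1 / 2 * (|w (x 2)| * ‖fderiv ℝ (curl V) x‖ ^ 2 + |w (x 2)| * ‖V x‖ ^ 2) := by ring
      _ ≤ 1 / 2 * (K * ‖fderiv ℝ (curl V) x‖ ^ 2 + K * SL.indicator (fun x => ‖V x‖ ^ 2) x) := by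
          refine mul_le_mul_of_nonneg_left (add_le_add (mul_le_mul_of_nonneg_right hu (sq_nonneg _)) hsl) (by norm_num)
  have iBterm : Integrable (fun x => w (x 2) * ⟪curl V x, fderiv ℝ (fun z : EuclideanSpace ℝ (Fin 3) => (-V z 1) • EuclideanSpace.single (0 : Fin 3) (1 : ℝ) + (V z 0) • EuclideanSpace.single (1 : Fin 3) (1 : ℝ)) x (EuclideanSpace.single (2 : Fin 3) (1 : ℝ))⟫) volume := by
    refine (((iZ.add iD).const_mul (K / 2))).mono' ((cw.mul (cω.inner (cDB.clm_apply continuous_const))).aestronglyMeasurable)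
      (Eventually.of_forall fun x => ?_)
    rw [Real.norm_eq_abs, abs_mul]
    simp only [Pi.add_apply]
    have h1' : |⟪curl V x, fderiv ℝ (fun z : EuclideanSpace ℝ (Fin 3) => (-V z 1) • EuclideanSpace.single (0 : Fin 3) (1 : ℝ) + (V z 0) • EuclideanSpace.single (1 : Fin 3) (1 : ℝ)) x (EuclideanSpace.single (2 : Fin 3) (1 : ℝ))⟫| ≤ ‖curl V x‖ * ‖fderiv ℝ V x‖ :=
      (abs_real_inner_le_norm _ _).trans (mul_le_mul_of_nonneg_left (nDB x) (norm_nonneg _))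
    calc |w (x 2)| * |⟪curl V x, fderiv ℝ (fun z : EuclideanSpace ℝ (Fin 3) => (-V z 1) • EuclideanSpace.single (0 : Fin 3) (1 : ℝ) + (V z 0) • EuclideanSpace.single (1 : Fin 3) (1 : ℝ)) x (EuclideanSpace.single (2 : Fin 3) (1 : ℝ))⟫| ≤ K * (‖curl V x‖ * ‖fderiv ℝ V x‖) :=
          mul_le_mul (hwK _) h1' (abs_nonneg _) hK0
      _ ≤ K / 2 * (‖curl V x‖ ^ 2 + ‖fderiv ℝ V x‖ ^ 2) := by nlinarith [sq_nonneg (‖curl V x‖ - ‖fderiv ℝ V x‖)]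
  have i2 : Integrable (fun x => w (x 2) * fderiv ℝ (fun y : EuclideanSpace ℝ (Fin 3) => ⟪curl V y, (-V y 1) • EuclideanSpace.single (0 : Fin 3) (1 : ℝ) + (V y 0) • EuclideanSpace.single (1 : Fin 3) (1 : ℝ)⟫) x (EuclideanSpace.single (2 : Fin 3) (1 : ℝ))) volume :=
    (iA.add iBterm).congr (Eventually.of_forall fun x => (hpt x).symm)
  have hax := integral_axialWeight_deriv_mul_eq hp hw1 i0 i1 i2
  -- the slide tail for the weight `w′`
  have htail := integral_slideTail_eq hv1 hdiv hw' hw1K hw2K hw1T hw2T iD hslab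
  have htail' : (∫ x, deriv w (x 2) * ⟪curl V x, (-V x 1) • EuclideanSpace.single (0 : Fin 3) (1 : ℝ) + (V x 0) • EuclideanSpace.single (1 : Fin 3) (1 : ℝ)⟫) =
      -(1 / 2) * ∫ x, deriv (deriv w) (x 2) * (‖V x‖ ^ 2 - 2 * (V x 2) ^ 2) := by
    rw [← htail]
    refine integral_congr_ae (Eventually.of_forall fun x => ?_)
    dsimp only
    rw [inner_curl_crossField]
  -- assemble: `∫w′p = −∫w∂₂p`, `∂₂p = ⟪∂₂ω,B⟫ + ⟪ω,∂₂B⟫`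
  rw [integral_congr_ae (Eventually.of_forall hpt), integral_add iA iBterm, htail'] at hax
  linarith

/-- **Jet form**: for the residue jet (`⟪V,c⟫ = −‖V‖²/2`, `c = (0,0,c₂)`, `c₂ ≠ 0`; flux invariance `∫θ′‖V‖² = 0`, p670434)
**`∫w(x₂)⟪∂₂ω, B⟫ = −∫w″(x₂)V₂² − ∫w(x₂)⟪ω, ∂₂B⟫`** — a `V₂`-term plus a quadratic-in-derivatives term. [folklore] -/
theorem integral_axialWeight_inner_fderiv_curl_crossField_jet (hV : ContDiff ℝ ∞ V) (hdiv : VectorCalculus.IsDivFree V)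
    (hVc : ∀ x, ⟪V x, c⟫ = -(‖V x‖ ^ 2 / 2)) (hc0 : c 0 = 0) (hc1 : c 1 = 0) (hc2 : c 2 ≠ 0)
    (hw : ContDiff ℝ 3 w) {K T : ℝ} (hT : 0 < T) (hwK : ∀ s, |w s| ≤ K) (hw1K : ∀ s, |deriv w s| ≤ K) (hw2K : ∀ s, |deriv (deriv w) s| ≤ K)
    (hwT : ∀ s, T ≤ |s| → w s = 0) (hw1T : ∀ s, T ≤ |s| → deriv w s = 0) (hw2T : ∀ s, T ≤ |s| → deriv (deriv w) s = 0)
    (h1 : ∫⁻ x, ‖iteratedFDeriv ℝ 1 V x‖ₑ ^ 2 < ⊤) (h2 : ∫⁻ x, ‖iteratedFDeriv ℝ 2 V x‖ₑ ^ 2 < ⊤)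
    (hslab : Integrable (fun x => {x : EuclideanSpace ℝ (Fin 3) | |x 2| ≤ T}.indicator (fun x => ‖V x‖ ^ 2) x) volume) :
    (∫ x, w (x 2) * ⟪fderiv ℝ (curl V) x (EuclideanSpace.single (2 : Fin 3) (1 : ℝ)), ((-V x 1) • EuclideanSpace.single (0 : Fin 3) (1 : ℝ) + (V x 0) • EuclideanSpace.single (1 : Fin 3) (1 : ℝ))⟫) =
      -(∫ x, deriv (deriv w) (x 2) * (V x 2) ^ 2) -
        ∫ x, w (x 2) * ⟪curl V x, fderiv ℝ (fun z : EuclideanSpace ℝ (Fin 3) => (-V z 1) • EuclideanSpace.single (0 : Fin 3) (1 : ℝ) + (V z 0) • EuclideanSpace.single (1 : Fin 3) (1 : ℝ)) x (EuclideanSpace.single (2 : Fin 3) (1 : ℝ))⟫ := by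
  have hw2 : ContDiff ℝ 2 w := hw.of_le (by norm_num)
  have hv1 : ContDiff ℝ 1 V := hV.of_le (WithTop.coe_le_coe.mpr le_top)
  have hθ : ContDiff ℝ 1 (deriv w) := by
    have h2' : ContDiff ℝ (1 + 1) w := by rw [show ((1 : WithTop ℕ∞) + 1) = 2 by norm_num]; exact hw2
    exact h2'.deriv'
  have hkin := integral_deriv_axialTest_mul_sq_eq_zero hv1 hdiv hVc hc0 hc1 hc2 hθ hT hw1T hslab
  rw [integral_axialWeight_inner_fderiv_curl_crossField hV hdiv hw2 hwK hw1K hw2K hwT hw1T hw2T h1 h2 hslab]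
  -- `∫w″(‖V‖² − 2V₂²) = ∫w″‖V‖² − 2∫w″V₂² = −2∫w″V₂²`
  have hK0 : 0 ≤ K := (abs_nonneg _).trans (hwK 0)
  have cw2 : Continuous fun x : EuclideanSpace ℝ (Fin 3) => deriv (deriv w) (x 2) :=
    (contDiff_one_iff_deriv.1 hθ).2.comp (PiLp.continuous_apply 2 _ (2 : Fin 3))
  have iN : Integrable (fun x => deriv (deriv w) (x 2) * ‖V x‖ ^ 2) volume := by
    refine (hslab.const_mul K).mono' ((cw2.mul (hV.continuous.norm.pow 2)).aestronglyMeasurable) (Eventually.of_forall fun x => ?_)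
    rw [Real.norm_eq_abs, abs_mul, abs_of_nonneg (sq_nonneg ‖V x‖)]
    by_cases hx : x ∈ {x : EuclideanSpace ℝ (Fin 3) | |x 2| ≤ T}
    · rw [Set.indicator_of_mem hx]; exact mul_le_mul_of_nonneg_right (hw2K _) (sq_nonneg _)
    · rw [hw2T _ (not_le.1 hx).le, abs_zero, zero_mul, Set.indicator_of_notMem hx, mul_zero]
  have i2 : Integrable (fun x => deriv (deriv w) (x 2) * (V x 2) ^ 2) volume :=
    integrable_axialWeight_mul_coord_sq hv1 (contDiff_one_iff_deriv.1 hθ).2 hw2K hw2T hslab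
  have hsplit : (∫ x, deriv (deriv w) (x 2) * (‖V x‖ ^ 2 - 2 * (V x 2) ^ 2)) =
      (∫ x, deriv (deriv w) (x 2) * ‖V x‖ ^ 2) - 2 * ∫ x, deriv (deriv w) (x 2) * (V x 2) ^ 2 := by
    rw [← integral_const_mul, ← integral_sub iN (i2.const_mul 2)]
    refine integral_congr_ae (Eventually.of_forall fun x => ?_); dsimp only; ring
  rw [hsplit, hkin]
  ring

end ExtremiserLiouville

end Summit.NavierStokesRegularity.NavierStokesRegularity.Theorems

end
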